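import Summits.BirchSwinnertonDyer.BirchSwinnertonDyer.Theorems.QuadraticBranchSignedControlPlusEtaNonsurjTwistedCongruenceTrace
import Summits.BirchSwinnertonDyer.BirchSwinnertonDyer.Theorems.QuadraticBranchSignedControlPlusEtaNonsurjUncongruentRecords01
import Summits.BirchSwinnertonDyer.Rank1Residual.X12.O11.RouteUTraceForm
import HarnessLib

/-!
# Route `QuadraticBranchSignedControl` (rung K8, cell `bsd-potss`): crux stmt-BirchSwinnertonDyer-19606
# `PlusEtaMainConjectureNonsurj` — UNCONGRUENT RECORDS, FINE DOOR: the rows whose Cartan field IS a class-number-one field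
# (`d_K ∈ {−7, −8, −43, −67, −163}`) but which have NO CM-curve anchor — certified by ONE split prime `ℓ` with
# `a_ℓ(V) ≢ ±a_ℓ(A₀) (mod 5)` against the reference CM curves `A₀` of that field (record tools + reference curves)

WHAT. `…TwistedCongruenceTrace.not_modPCongruent_of_frobeniusTrace_ne_of_j_eq` (this seat): a good prime `ℓ ≠ 5` with
`a_ℓ(V) ≢ ±a_ℓ(A₀) (mod 5)` excludes every curve with `j = j(A₀) ∉ {0, 1728}` as a `5`-anchor of `V`. A CM anchor with CM field
`ℚ(√d)`, `d ∈ {−7, −8, −43, −67, −163}`, has `j ∈ {−3375, 16581375}`, `{8000}`, `{−884736000}`, `{−147197952000}`,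
`{−262537412640768000}` respectively (`j_eq_of_hasCM_of_cmFieldDiscrOfJ_eq_*`, from `hasCM_iff_j_mem_holds` and the table
`cmFieldDiscrOfJ`). §1 fixes six REFERENCE CURVES `A₀` (Cremona `49a1`, `49a3`, `256a1`-type `[0,4,0,2,0]`, `1849a1`, `4489a1`,
`26569a1`: `Δ ≠ 0`, global minimality and `j` IN THE KERNEL; minimality of `49a1` is the tree's `X12.O11.RouteU.isGloballyMinimal_X049_eq`); §2 the per-field doors `not_modPCongruent_of_hasCM_of_cmField_*`
(hypotheses: the field `d`, a prime `ℓ ≠ 5` good for `V` and `A₀`, and the two non-divisibilities); §3 the record shape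
`uncongruentFine_of_counts`: eight Frobenius data (for the discriminants `≠ d₀`) + the fine door at `d₀` ⟹ the negated existential of
`Sig.stub_etaMC_nonCM_uncongruent` VERBATIM. Records: siblings `…UncongruentRecordsFine01…`.

HONEST FRAMING (cell `bsd-potss`, run/shared/lean/pub/bsd-potss/; FULL-BSD rank ≤ 1 programme): TOOL THEOREMS ONLY (no definition,
no named fact, no `sorry`, axioms standard). Nothing is booked; crux 19606 stays OPEN; `BSD(W, p)` is claimed for no pair. Seat
`bsd-potss-k8eta-c2` g14 (prover), `--supports stmt-BirchSwinnertonDyer-19606`.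

References: [SilvermanAdvancedTopics1994] App. A §3 (CM curves and `j`-invariants); [Cremona1997] Table 1 (49a, 256a, 1849a, 4489a,
26569a); [SilvermanAEC2009] X.5 Cor. 5.4.1, VII.1 Rem. 1.1; [Serre1981] §8.1 (238).
-/

set_option autoImplicit false
set_option linter.dupNamespace false

noncomputable section

open scoped Classical

open WeierstrassCurve Literature.NumberTheory.EllipticCurves Literature.NumberTheory.EllipticCurves.Rank1Residual
  Literature.NumberTheory.EllipticCurves.Rank1Residual.X11RankOneCertificates
  Summit.BirchSwinnertonDyer.Rank1Residual.X11b Summit.BirchSwinnertonDyer.BirchSwinnertonDyer.Rank1Residual.IntModel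
  Summit.BirchSwinnertonDyer.BirchSwinnertonDyer.Rank1Residual.X11RankOne
open Summit.BirchSwinnertonDyer.Rank1Residual.O6 (ModPCongruent)

namespace Summit.BirchSwinnertonDyer.BirchSwinnertonDyer.Theorems.EtaUncongruentRecords

open Summit.BirchSwinnertonDyer.BirchSwinnertonDyer.Theorems.EtaCartanField

/-! ## §0 The CM `j`-invariants with a given field -/

/-- The CM `j`-invariants with CM field `ℚ(√−7)` are `−3375` and `16581375`; with `ℚ(√−2)`: `8000`; with `ℚ(√−43)`, `ℚ(√−67)`,
`ℚ(√−163)`: `−884736000`, `−147197952000`, `−262537412640768000` (Silverman *AT* App. A §3; the tree's table `cmFieldDiscrOfJ`).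
[cite: SilvermanAdvancedTopics1994, App. A §3] -/
theorem j_mem_of_hasCM_of_cmFieldDiscrOfJ_eq (A : WeierstrassCurve ℚ) [A.IsElliptic] (hCM : A.HasCM) :
    (cmFieldDiscrOfJ A.j = -7 → A.j = -3375 ∨ A.j = 16581375) ∧ (cmFieldDiscrOfJ A.j = -8 → A.j = 8000) ∧
    (cmFieldDiscrOfJ A.j = -43 → A.j = -884736000) ∧ (cmFieldDiscrOfJ A.j = -67 → A.j = -147197952000) ∧
    (cmFieldDiscrOfJ A.j = -163 → A.j = -262537412640768000) := by
  have hj := (hasCM_iff_j_mem_holds A).mp hCM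
  simp only [cmJInvariants, Finset.mem_insert, Finset.mem_singleton] at hj
  rcases hj with h | h | h | h | h | h | h | h | h | h | h | h | h <;> rw [h] <;> norm_num [cmFieldDiscrOfJ]

/-! ## §1 Reference curves: `Δ ≠ 0`, minimality, `j` (kernel) -/

/-- `49a1 = [1,−1,0,−2,−1]`: `Δ = −7³ ≠ 0`. [cite: Cremona1997, Table 1 (49a1)] -/
theorem isElliptic_A7a : (⟨1, -1, 0, -2, -1⟩ : WeierstrassCurve ℚ).IsElliptic :=
  isElliptic_of_discOf_ne_zero 1 (-1) 0 (-2) (-1) (by decide +kernel)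
-- global minimality of `49a1` is the tree's `Summit.BirchSwinnertonDyer.Rank1Residual.X12.O11.RouteU.isGloballyMinimal_X049_eq`
/-- `j(49a1) = −3375`. [cite: Cremona1997, Table 1 (49a1)] -/
theorem j_A7a : @WeierstrassCurve.j ℚ _ ⟨1, -1, 0, -2, -1⟩ isElliptic_A7a = -3375 := by
  rw [@j_eq_c₄_pow_div _ isElliptic_A7a]; norm_num [WeierstrassCurve.c₄, WeierstrassCurve.b₂, WeierstrassCurve.b₄,
    WeierstrassCurve.Δ, WeierstrassCurve.b₆, WeierstrassCurve.b₈]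

/-- `49a3 = [1,−1,0,−37,−78]`: `Δ = 7³ ≠ 0`. [cite: Cremona1997, Table 1 (49a3)] -/
theorem isElliptic_A7b : (⟨1, -1, 0, -37, -78⟩ : WeierstrassCurve ℚ).IsElliptic :=
  isElliptic_of_discOf_ne_zero 1 (-1) 0 (-37) (-78) (by decide +kernel)
/-- `49a3` is a global minimal equation (kernel). [cite: Cremona1997, Table 1 (49a3)] -/
theorem isGloballyMinimal_A7b : (⟨1, -1, 0, -37, -78⟩ : WeierstrassCurve ℚ).IsGloballyMinimal :=
  isGloballyMinimal_of_krausCriterion_support 1 (-1) 0 (-37) (-78) [(7, 2, 3)] (by decide +kernel) (by decide +kernel) (by decide +kernel)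
/-- `j(49a3) = 16581375`. [cite: Cremona1997, Table 1 (49a3)] -/
theorem j_A7b : @WeierstrassCurve.j ℚ _ ⟨1, -1, 0, -37, -78⟩ isElliptic_A7b = 16581375 := by
  rw [@j_eq_c₄_pow_div _ isElliptic_A7b]; norm_num [WeierstrassCurve.c₄, WeierstrassCurve.b₂, WeierstrassCurve.b₄,
    WeierstrassCurve.Δ, WeierstrassCurve.b₆, WeierstrassCurve.b₈]

/-- `[0,4,0,2,0]` (`j = 8000`, conductor `256`): `Δ = 2⁹ ≠ 0`. [cite: SilvermanAdvancedTopics1994, App. A §3] -/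
theorem isElliptic_A8 : (⟨0, 4, 0, 2, 0⟩ : WeierstrassCurve ℚ).IsElliptic :=
  isElliptic_of_discOf_ne_zero 0 4 0 2 0 (by decide +kernel)
/-- `[0,4,0,2,0]` is a global minimal equation (kernel). [cite: SilvermanAEC2009, VII.1 Remark 1.1] -/
theorem isGloballyMinimal_A8 : (⟨0, 4, 0, 2, 0⟩ : WeierstrassCurve ℚ).IsGloballyMinimal :=
  isGloballyMinimal_of_krausCriterion_support 0 4 0 2 0 [(2, 8, 9)] (by decide +kernel) (by decide +kernel) (by decide +kernel)
/-- `j([0,4,0,2,0]) = 8000`. [cite: SilvermanAdvancedTopics1994, App. A §3] -/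
theorem j_A8 : @WeierstrassCurve.j ℚ _ ⟨0, 4, 0, 2, 0⟩ isElliptic_A8 = 8000 := by
  rw [@j_eq_c₄_pow_div _ isElliptic_A8]; norm_num [WeierstrassCurve.c₄, WeierstrassCurve.b₂, WeierstrassCurve.b₄,
    WeierstrassCurve.Δ, WeierstrassCurve.b₆, WeierstrassCurve.b₈]

/-- `1849a1 = [0,0,1,−860,9707]`: `Δ = −43³ ≠ 0`. [cite: Cremona1997, Table 1 (1849a1)] -/
theorem isElliptic_A43 : (⟨0, 0, 1, -860, 9707⟩ : WeierstrassCurve ℚ).IsElliptic :=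
  isElliptic_of_discOf_ne_zero 0 0 1 (-860) 9707 (by decide +kernel)
/-- `1849a1` is a global minimal equation (kernel). [cite: Cremona1997, Table 1 (1849a1)] -/
theorem isGloballyMinimal_A43 : (⟨0, 0, 1, -860, 9707⟩ : WeierstrassCurve ℚ).IsGloballyMinimal :=
  isGloballyMinimal_of_krausCriterion_support 0 0 1 (-860) 9707 [(43, 2, 3)] (by decide +kernel) (by decide +kernel) (by decide +kernel)
/-- `j(1849a1) = −884736000`. [cite: Cremona1997, Table 1 (1849a1)] -/
theorem j_A43 : @WeierstrassCurve.j ℚ _ ⟨0, 0, 1, -860, 9707⟩ isElliptic_A43 = -884736000 := by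
  rw [@j_eq_c₄_pow_div _ isElliptic_A43]; norm_num [WeierstrassCurve.c₄, WeierstrassCurve.b₂, WeierstrassCurve.b₄,
    WeierstrassCurve.Δ, WeierstrassCurve.b₆, WeierstrassCurve.b₈]

/-- `4489a1 = [0,0,1,−7370,243528]`: `Δ = −67³ ≠ 0`. [cite: Cremona1997, Table 1 (4489a1)] -/
theorem isElliptic_A67 : (⟨0, 0, 1, -7370, 243528⟩ : WeierstrassCurve ℚ).IsElliptic :=
  isElliptic_of_discOf_ne_zero 0 0 1 (-7370) 243528 (by decide +kernel)
/-- `4489a1` is a global minimal equation (kernel). [cite: Cremona1997, Table 1 (4489a1)] -/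
theorem isGloballyMinimal_A67 : (⟨0, 0, 1, -7370, 243528⟩ : WeierstrassCurve ℚ).IsGloballyMinimal :=
  isGloballyMinimal_of_krausCriterion_support 0 0 1 (-7370) 243528 [(67, 2, 3)] (by decide +kernel) (by decide +kernel)
    (by decide +kernel)
/-- `j(4489a1) = −147197952000`. [cite: Cremona1997, Table 1 (4489a1)] -/
theorem j_A67 : @WeierstrassCurve.j ℚ _ ⟨0, 0, 1, -7370, 243528⟩ isElliptic_A67 = -147197952000 := by
  rw [@j_eq_c₄_pow_div _ isElliptic_A67]; norm_num [WeierstrassCurve.c₄, WeierstrassCurve.b₂, WeierstrassCurve.b₄,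
    WeierstrassCurve.Δ, WeierstrassCurve.b₆, WeierstrassCurve.b₈]

/-- `26569a1 = [0,0,1,−2174420,1234136692]`: `Δ = −163³ ≠ 0`. [cite: Cremona1997, Table 1 (26569a1)] -/
theorem isElliptic_A163 : (⟨0, 0, 1, -2174420, 1234136692⟩ : WeierstrassCurve ℚ).IsElliptic :=
  isElliptic_of_discOf_ne_zero 0 0 1 (-2174420) 1234136692 (by decide +kernel)
/-- `26569a1` is a global minimal equation (kernel). [cite: Cremona1997, Table 1 (26569a1)] -/
theorem isGloballyMinimal_A163 : (⟨0, 0, 1, -2174420, 1234136692⟩ : WeierstrassCurve ℚ).IsGloballyMinimal :=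
  isGloballyMinimal_of_krausCriterion_support 0 0 1 (-2174420) 1234136692 [(163, 2, 3)] (by decide +kernel) (by decide +kernel)
    (by decide +kernel)
/-- `j(26569a1) = −262537412640768000`. [cite: Cremona1997, Table 1 (26569a1)] -/
theorem j_A163 : @WeierstrassCurve.j ℚ _ ⟨0, 0, 1, -2174420, 1234136692⟩ isElliptic_A163 = -262537412640768000 := by
  rw [@j_eq_c₄_pow_div _ isElliptic_A163]; norm_num [WeierstrassCurve.c₄, WeierstrassCurve.b₂, WeierstrassCurve.b₄,
    WeierstrassCurve.Δ, WeierstrassCurve.b₆, WeierstrassCurve.b₈]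

/-! ## §2 The fine door against one reference curve, from counts -/

/-- **Fine door from counts.** `V` (integral model `[a₁,…,a₆]`) is `5`-congruent to NO curve `A` with `j(A) = j(A₀)` (`A₀ = [b₁,…,b₆]` a
reference curve, `j ∉ {0,1728}`) as soon as one prime `ℓ ≠ 2, 5` with `ℓ ∤ Δ(V)·Δ(A₀)` has `a_ℓ(V) ≢ ±a_ℓ(A₀) (mod 5)`, the two traces
read off `countPoints`. [cite: Serre1981, §8.1 (238)] [cite: SilvermanAEC2009, X.5 Cor. 5.4.1] -/
theorem not_modPCongruent_of_counts_of_j_eq (V : WeierstrassCurve ℚ) [V.IsElliptic] [V.IsGloballyMinimal] [Fact (5 : ℕ).Prime]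
    {a1 a2 a3 a4 a6 : ℤ} (hI : integralModelInt V = ⟨a1, a2, a3, a4, a6⟩)
    (A₀ : WeierstrassCurve ℚ) [A₀.IsElliptic] [A₀.IsGloballyMinimal] {b1 b2 b3 b4 b6 : ℤ} (hI₀ : integralModelInt A₀ = ⟨b1, b2, b3, b4, b6⟩)
    (h0 : A₀.j ≠ 0) (h1728 : A₀.j ≠ 1728) {A : WeierstrassCurve ℚ} [A.IsElliptic] (hj : A.j = A₀.j)
    (ℓ : ℕ) [Fact ℓ.Prime] (hℓ5 : ℓ ≠ 5) (hℓ2 : ℓ ≠ 2) (hΔ : ¬ (ℓ : ℤ) ∣ discOf [a1, a2, a3, a4, a6])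
    (hΔ₀ : ¬ (ℓ : ℤ) ∣ discOf [b1, b2, b3, b4, b6])
    (h1 : ¬ (5 : ℤ) ∣ ((ℓ : ℤ) + 1 - countPoints [a1, a2, a3, a4, a6] ℓ) - ((ℓ : ℤ) + 1 - countPoints [b1, b2, b3, b4, b6] ℓ))
    (h2 : ¬ (5 : ℤ) ∣ ((ℓ : ℤ) + 1 - countPoints [a1, a2, a3, a4, a6] ℓ) + ((ℓ : ℤ) + 1 - countPoints [b1, b2, b3, b4, b6] ℓ)) :
    ¬ ModPCongruent V A 5 := by
  obtain ⟨hgV, htV⟩ := good_and_frobeniusTrace_eq_of_countPoints hI ℓ hℓ2 hΔ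
  obtain ⟨hgA, htA⟩ := good_and_frobeniusTrace_eq_of_countPoints hI₀ ℓ hℓ2 hΔ₀
  refine not_modPCongruent_of_frobeniusTrace_ne_of_j_eq V 5 A₀ hj h0 h1728 ℓ hℓ5 hgV hgA ?_ ?_
  · rw [htV, htA]; exact_mod_cast h1
  · rw [htV, htA]; exact_mod_cast h2

/-! ## §3 Record shape: eight Frobenius data and the fine door at the row's own field -/

/-- **Fine record shape.** For `V = [a₁,…,a₆]` globally minimal, `5 ∤ Δ`, `#E(𝔽₅) = 6`, `5`-adic tower not onto: if every CM
anchor with field `ℚ(√d₀)` is excluded (`htw`, from §2) and for each other class-number-one `d` a Frobenius datum is given, then NO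
globally minimal CM curve good at `5` with `a_5 = 0` is `5`-congruent to `V` (negated existential of `Sig.stub_etaMC_nonCM_uncongruent`).
[cite: Serre1972, §4.5] [cite: NeukirchANT1999, Ch. I §8 Prop. (8.5)] -/
theorem uncongruentFine_of_counts (V : WeierstrassCurve ℚ) [V.IsElliptic] [V.IsGloballyMinimal] [Fact (5 : ℕ).Prime]
    {a1 a2 a3 a4 a6 : ℤ} (hI : integralModelInt V = ⟨a1, a2, a3, a4, a6⟩)
    (hΔ5 : ¬ (5 : ℤ) ∣ discOf [a1, a2, a3, a4, a6]) (hc5 : countPoints [a1, a2, a3, a4, a6] 5 = 6)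
    (hns : ¬ ∀ m : ℕ, V.HasSurjectiveModNGaloisRep (5 ^ m : ℕ)) (d₀ : ℤ)
    (htw : ∀ (A : WeierstrassCurve ℚ) [A.IsElliptic], A.HasCM → cmFieldDiscrOfJ A.j = d₀ → ¬ ModPCongruent V A 5)
    (h : ∀ d ∈ ({-3, -4, -7, -8, -11, -19, -43, -67, -163} : Finset ℤ), d ≠ d₀ → ∃ (ℓ : ℕ) (_ : Fact ℓ.Prime),
      ℓ ≠ 5 ∧ ℓ ≠ 2 ∧ V.HasGoodReductionAtPrime ℓ ∧ ¬ (5 : ℤ) ∣ V.frobeniusTrace ℓ ∧ jacobiSym d ℓ = -1) :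
    ¬ ∃ (V'' : WeierstrassCurve ℚ) (_ : V''.IsElliptic) (_ : V''.IsGloballyMinimal),
        V''.HasCM ∧ V''.HasGoodReductionAtPrime 5 ∧ V''.frobeniusTrace 5 = 0 ∧ ModPCongruent V'' V 5 := by
  obtain ⟨hgood, htr⟩ := good_and_frobeniusTrace_eq_of_countPoints hI 5 (by decide) (by exact_mod_cast hΔ5)
  rw [hc5] at htr
  have hap : V.frobeniusTrace 5 = 0 := by rw [htr]; norm_num
  rintro ⟨A, _, _, hCM, -, -, hAV⟩
  have hVA : ModPCongruent V A 5 := by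
    obtain ⟨e, he⟩ := hAV
    refine ⟨e.symm, fun σ P => e.injective ?_⟩
    rw [e.apply_symm_apply, he, e.apply_symm_apply]
  by_cases hd : cmFieldDiscrOfJ A.j = d₀
  · exact htw A hCM hd hVA
  · obtain ⟨ℓ, _, hℓ5, hℓ2, hgoodℓ, ha, hjac⟩ := h _ (cmFieldDiscrOfJ_mem_nine_of_hasCM A hCM) hd
    exact not_modPCongruent_of_hasCM_of_frob_jacobiSym V 5 le_rfl hgood hap hns hCM ℓ hℓ5 hℓ2 hgoodℓ ha hjac hVA

end Summit.BirchSwinnertonDyer.BirchSwinnertonDyer.Theorems.EtaUncongruentRecords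

end
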